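import Summits.QuantumFields.BalabanUV.Beta.HessKerDressedUnits

/-!
# `BalabanUV.Beta.D1BFx.UnitsOnlyK` — THE ONLY-K-RESCALED UNITS LEMMA: `hessKer` of the rescaled resolvent `D K D` against UNCHANGED tables equals
# `hessKer` of `K` against the INVERSELY co-dressed tables — the kernel FRAME of CHECK N0(c) of road «BF-x» (row D1)

AUTHORSHIP.  Theorems (a₁)/(a₂)/(b) and the two examples (c) are asym1-g27's probe `HOME/b2b-balaban-beta-asym1-g27/ReplyN0cUnits.lean`
(sha16 db38f9adb870afce; planner-b2b-balaban-beta-asym1-g27-0, REPLY CLAIMS.log l.5473 to beta-d1-p2's CHECK N0 l.5319) filed BYTE-FOR-BYTE by the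
courier beta-d1-p2 (prover-b2b-balaban-beta-d1-p2-0) at asym1's offer; namespace renamed, header rewritten, trailing `#print axioms` dropped.

HONEST FRAMING (cell contract, verbatim): «discharging `BetaPertH` makes Bałaban's UV stability UNCONDITIONAL — a real constructive-QFT
result; it is NOT the continuum limit and NOT the Clay problem.»  Units bookkeeping only ([folklore] algebra over asym1's `HessKerDressedUnits`
BY NAME); cites nothing, mints no `Prop`, discharges nothing; 0 binders instantiated; NOT summit progress; NOT continuum, NOT Clay.

WHY (CHECK N0(c) of skeleton `HOME/beta/skeletons/D1-b2b-balaban-beta-d1-p2.md`, file `HOME/b2b-balaban-beta-d1-p2/CHECK-N0.md` v1.1).  The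
one-shot coefficient `D1BFx.FirstStepLargeBlock.shotCoeff` carries an exponent socket `e` (block-size powers of the colour weights).  asym1's
`HessKerDressedUnits.hessKer_dress_unit` is an INVARIANCE (move `K`, `S`, `W` to new units together: factor 1).  What N0(c) compares is the Hessian
of the RESCALED resolvent `D K D` against the SAME tables; (b) below reduces that to the raw `K` against the inversely co-dressed tables, so THE
EXPONENT SOCKET IS DECIDABLE PER TABLE: an entry of `S κ u` picks up `(s_f s_m)·(leg a)·(leg b)` (field leg `s_f`, multiplier leg `s_m`;
examples (c)), an entry of `W` the two leg factors, and `hessKer` is quadratic in `S`, linear in `W`.  Which powers each typed table carries is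
TABLE CONTENT for the table owners' absolute units audit (BINDER-OWNERS row D1 item (p)); nothing about it is asserted here.

CONTENT ([folklore]): (a₁) `unitS_unitS_inv`, (a₂) `unitW_unitW_inv`; (b) `hessKer_unitK_only`; (c) two `example`s of the entrywise scaling.
-/

open Literature.MathematicalPhysics.QuantumFieldTheory.Balaban1983to89
open Literature.MathematicalPhysics.QuantumFieldTheory.Balaban1983to89.Beta
open ExpKernelCalculus (MKer hessKer)
open OneStepResolventKernel (Fib)
open AxialDressing (axDressK axVertexOfK)
open Summit.QuantumFields.BalabanUV.Beta.HessKerDressedUnits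

namespace Summit.QuantumFields.BalabanUV.Beta.D1BFx.UnitsOnlyK

variable {d : ℕ}

/-- (a₁) inverse units undo `unitS` (entrywise: `(s_f s_m)⁻¹·((s_f⁻¹ s_m⁻¹)⁻¹)` and `D⁻¹·D` legwise). -/
theorem unitS_unitS_inv {sf sm : ℝ} (hsf : sf ≠ 0) (hsm : sm ≠ 0)
    (S : Fin (d + 1) → (Fin (d + 1) → ℤ) → MKer (d + 1) (Fib d)) : unitS sf sm (unitS sf⁻¹ sm⁻¹ S) = S := by
  funext κ u x y a b
  simp only [unitS_apply, inv_inv]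
  rcases a with α | m <;> rcases b with β | m' <;> simp only [legScale_inl, legScale_inr] <;> field_simp

/-- (a₂) inverse units undo `unitW`. -/
theorem unitW_unitW_inv {sf sm : ℝ} (hsf : sf ≠ 0) (hsm : sm ≠ 0)
    (W : Fin (d + 1) → (Fin (d + 1) → ℤ) → Fin (d + 1) → (Fin (d + 1) → ℤ) → MKer (d + 1) (Fib d)) :
    unitW sf sm (unitW sf⁻¹ sm⁻¹ W) = W := by
  funext μ y ν y' x z a b
  simp only [unitW_apply, inv_inv]
  rcases a with α | m <;> rcases b with β | m' <;> simp only [legScale_inl, legScale_inr] <;> field_simp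

/-- (b) ONLY-K-RESCALED form of asym1's invariance lemma `hessKer_dress_unit`: the Hessian of `D K D` against the SAME tables is the Hessian
of `K` against the inversely co-dressed tables.  With `(s_f, s_m) = (n, n⁴)` this is the frame of N0(c): its block-size power is whatever
`unitS n⁻¹ n⁻⁴` ∕ `unitW n⁻¹ n⁻⁴` do to each typed table (leg by leg: a field leg × `n`, a multiplier leg × `n⁴`, and `× n⁵` overall on `S`). -/
theorem hessKer_unitK_only {sf sm : ℝ} (hsf : sf ≠ 0) (hsm : sm ≠ 0) (N : ℕ) (K : MKer (d + 1) (Fib d))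
    (S : Fin (d + 1) → (Fin (d + 1) → ℤ) → MKer (d + 1) (Fib d))
    (W : Fin (d + 1) → (Fin (d + 1) → ℤ) → Fin (d + 1) → (Fin (d + 1) → ℤ) → MKer (d + 1) (Fib d)) :
    hessKer (axDressK N (unitK sf sm K)) (axVertexOfK (unitK sf sm K) N S) W =
      hessKer (axDressK N K) (axVertexOfK K N (unitS sf⁻¹ sm⁻¹ S)) (unitW sf⁻¹ sm⁻¹ W) := by
  conv_lhs => rw [← unitS_unitS_inv hsf hsm S, ← unitW_unitW_inv hsf hsm W]
  exact hessKer_dress_unit hsf hsm N K _ _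

/-- (c) the entrywise scaling of a table entry under the inverse co-dressing, e.g. a FIELD–FIELD entry of `S` picks up `(s_f s_m)·s_f²`
(= `n⁵·n²` at `(n, n⁴)`), a MULTIPLIER–MULTIPLIER entry `(s_f s_m)·s_m²` (= `n⁵·n⁸`): the exponent socket is table-by-table leg content. -/
example {sf sm : ℝ} (S : Fin (d + 1) → (Fin (d + 1) → ℤ) → MKer (d + 1) (Fib d)) (κ : Fin (d + 1)) (u x y : Fin (d + 1) → ℤ)
    (α β : Fin (d + 1)) :
    unitS sf⁻¹ sm⁻¹ S κ u x y (Sum.inl α) (Sum.inl β) = (sf * sm) * sf ^ 2 * S κ u x y (Sum.inl α) (Sum.inl β) := by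
  simp only [unitS_apply, inv_inv, legScale_inl, mul_inv]; ring

example {sf sm : ℝ} (S : Fin (d + 1) → (Fin (d + 1) → ℤ) → MKer (d + 1) (Fib d)) (κ : Fin (d + 1)) (u x y : Fin (d + 1) → ℤ)
    (m m' : Fin (d + 1)) :
    unitS sf⁻¹ sm⁻¹ S κ u x y (Sum.inr m) (Sum.inr m') = (sf * sm) * sm ^ 2 * S κ u x y (Sum.inr m) (Sum.inr m') := by
  simp only [unitS_apply, inv_inv, legScale_inr, mul_inv]; ring

end Summit.QuantumFields.BalabanUV.Beta.D1BFx.UnitsOnlyK
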